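import Summits.CriticalPhenomena.PercolationContinuityZ3.Theorems.PercNearOneGluingNoHeavyQuantDIBStar
import HarnessLib

/-!
# QUANT lane R8, Conjecture DIB\* — the FLOOR-SPLIT architecture (lead g17): rule φ (two-floor conditioning on one blob),
# the disjunction-of-giants rule and the witness rule, as TERM certificates

builds on p205010 (kernel theorem, internal audit signed; external expert review pending)

Support file (`--supports stmt-CriticalPhenomena-4575`), QUANT lane lead (gen 17); memo
`run/shared/lean/prim/quant/prim-quant-lead-g17/LEAD-NOTES-G17.md` N33.  Theorems only, no definitions, no sorries, standard
axioms; vocabulary of `…QuantRootReduction` / `…QuantDIBStar` (`TERM[s, a, g, j] = P(s + Σ_{k open} a k ≥ j+1)`).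

ARCHITECTURE FS (floor-split induction) for Conjecture DIB\* (`Quant.IndepBlob.DIBStar`, open in the corner `1/2 < x < 1`,
heavy total `≤ 2j`, at least two light blobs).  Condition on ONE blob `k` (rule δ of ARCH-TREES-G49 §2.4 conditions on a light GIANT
and keeps the floor; here ANY blob, and the two branches get DIFFERENT floors):
`TERM[s, a, g, j] = g k · TERM[s + a k, a[k ↦ 0], g, j] + (1 − g k) · TERM[s, a[k ↦ 0], g, j]` (`RootDec.term_cond`), so
**`x ≤ TERM[s, a, g, j]` as soon as `z₁ ≤ TERM[s + a k, a[k↦0], g, j]`, `z₀ ≤ TERM[s, a[k↦0], g, j]` and `x ≤ g k·z₁ + (1 − g k)·z₀`**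
(`term_ge_of_floorSplit`, rule φ).  The two branch bounds are systems with ONE BLOB FEWER, so DIB\* at floors `z₁ > x > z₀` is
available for them BY INDUCTION on the number of blobs (the inductive hypothesis is DIB\* itself at every floor and layer — the branches
are literal sub-systems, so 'carry the system, not a gap summary' (LEAD-NOTES-G16 N31 (3)) holds automatically).  With the branch menu
{β sure (`term_eq_one_of_sure`), α′ size row (`term_ge_of_extraBlobs`), γ capped DIB\* credit AT THE BRANCH FLOOR (`term_ge_of_dibWith_capped`
= the inductive hypothesis), ∨ disjunction of giants (`term_ge_disj_giants`, this file), ∧ one witness set (`prod_le_term_of_witness`,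
this file)} the step succeeds on EVERY hard corner instance tested (lead g17, exact enumeration, explore/floorsplit4–10.py):
exhaustive gates k/12, ≤ 5 blobs, sizes ≤ 3, j ≤ 4: 27 318 / 0 failures; gates k/16, ≤ 4 blobs, sizes ≤ 4, j ≤ 5: 18 206 / 0;
random corner instances 4 000 / 0 and credit-tight (credit = 2j⁺) 1 061 + 1 434 / 0 — whereas every FIXED choice of the blob
(least/most reliable light, largest light, largest heavy) fails on 0.1–0.3 % and the pure-credit menu {β, α′, γ} on ≈ 1 %.
So DIB\* ⟸ STEP LEMMA ('for every corner instance some blob k and floor z₁ make both branch certificates fire'), a closed-form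
∀∃ real inequality per combinatorial type; the kernel now holds every ingredient of the step.  Nothing here proves the step lemma.

* `Quant.RootDec.term_nonneg`, `term_le_one` — `0 ≤ TERM ≤ 1` (gates in `[0,1]`).
* `Quant.RootDec.term_ge_of_floorSplit` — rule φ above.
* `Quant.RootDec.term_ge_disj_giants` — rule ∨: for any finset `G` of giants (`j + 1 ≤ s + a k`), `1 − ∏_{k∈G} (1 − g k) ≤ TERM`.
* `Quant.RootDec.prod_le_term_of_witness` — rule ∧: for any finset `S` with `j + 1 ≤ s + Σ_{k∈S} a k`, `∏_{k∈S} g k ≤ TERM`.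

NOVELTY.  presearch: 'lower bound tail of weighted Bernoulli sum by conditioning on one summand with two different thresholds /
floors, induction on the number of summands' → none specific (corpus hybrid + vsearch: generic Chernoff/Paley–Zygmund pages; galaxy
'conditioning argument|one variable at a time': unrelated); rule φ generalises rule δ of this lane's ARCH-TREES-G49 §2.4 (`z₁ = 1`,
`z₀ = (x − g)/(1 − g)`).  [this work; this lane's census]; the gluing rows served [cite: KozmaNitzan2024, Conjecture 3 (p. 15)];
product weights [cite: Grimmett1999, §1.3 p. 10].
-/

namespace Summit.CriticalPhenomena.PercolationContinuityZ3.Theorems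

namespace Quant

namespace RootDec

open Finset

variable {κ : Type} [Fintype κ] [DecidableEq κ]

/-- product-Bernoulli weight of the set `W` of open blobs (as in `…QuantRootReduction`) -/
local notation3 "wt[" g ", " W "]" => ∏ k, (if k ∈ (W : Finset κ) then (g : κ → ℝ) k else 1 - (g : κ → ℝ) k)

/-- the TERM tail `P(s + Σ_{k open} a k ≥ j+1)` (as in `…QuantRootReduction`) -/
local notation3 "TERM[" s ", " a ", " g ", " j "]" =>
  ∑ W : Finset κ, wt[g, W] * (if (j : ℕ) + 1 ≤ (s : ℕ) + ∑ k ∈ W, (a : κ → ℕ) k then (1 : ℝ) else 0)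

/-! ### 0. Range of a term -/

/-- `0 ≤ TERM[s, a, g, j]` (gates in `[0,1]`). [this work] -/
theorem term_nonneg (s : ℕ) (a : κ → ℕ) (g : κ → ℝ) (j : ℕ) (hg : ∀ k, 0 ≤ g k ∧ g k ≤ 1) : 0 ≤ TERM[s, a, g, j] :=
  Finset.sum_nonneg fun W _ => mul_nonneg (IndepBlob.bernoulliWeight_nonneg (fun k => (hg k).1) (fun k => (hg k).2) W)
    (by split_ifs <;> norm_num)

/-- `TERM[s, a, g, j] ≤ 1` (gates in `[0,1]`). [this work] -/
theorem term_le_one (s : ℕ) (a : κ → ℕ) (g : κ → ℝ) (j : ℕ) (hg : ∀ k, 0 ≤ g k ∧ g k ≤ 1) : TERM[s, a, g, j] ≤ 1 := by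
  calc TERM[s, a, g, j] ≤ ∑ W : Finset κ, wt[g, W] := Finset.sum_le_sum fun W _ => by
          refine mul_le_of_le_one_right (IndepBlob.bernoulliWeight_nonneg (fun k => (hg k).1) (fun k => (hg k).2) W) ?_
          split_ifs <;> norm_num
    _ = 1 := IndepBlob.sum_bernoulliWeight g

/-! ### 1. Rule φ — the floor split -/

/-- **Rule φ (FLOOR SPLIT on blob `k`).**  If the branch '`k` open' (sure mass `s + a k`, blob `k` emptied) has tail `≥ z₁`, the branch
'`k` closed' has tail `≥ z₀`, and `x ≤ g k·z₁ + (1 − g k)·z₀` with `0 ≤ g k ≤ 1`, then `x ≤ TERM[s, a, g, j]`.  In the floor-split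
induction `z₁ > x > z₀` are two FLOORS at which the smaller systems are certified (by DIB\* inductively, or by β/α′/∨/∧). [this work] -/
theorem term_ge_of_floorSplit (s : ℕ) (a : κ → ℕ) (g : κ → ℝ) (j : ℕ) (k : κ) (x z₁ z₀ : ℝ) (hgk : 0 ≤ g k ∧ g k ≤ 1)
    (h₁ : z₁ ≤ TERM[s + a k, Function.update a k 0, g, j]) (h₀ : z₀ ≤ TERM[s, Function.update a k 0, g, j])
    (hx : x ≤ g k * z₁ + (1 - g k) * z₀) : x ≤ TERM[s, a, g, j] := by
  rw [term_cond s a g j k]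
  exact hx.trans (add_le_add (mul_le_mul_of_nonneg_left h₁ hgk.1) (mul_le_mul_of_nonneg_left h₀ (by linarith [hgk.2])))

/-! ### 2. Rule ∨ — disjunction of giants -/

/-- **Rule ∨ (DISJUNCTION OF GIANTS).**  Gates in `[0,1]`; `G` any finset of giants (`j + 1 ≤ s + a k` for `k ∈ G`).  Then
`1 − ∏_{k∈G} (1 − g k) ≤ TERM[s, a, g, j]`: the term is at least the probability that SOME giant is open.  (Induction on `G` with
`term_cond`: for a giant `k`, `1 − TERM = (1 − g k)·(1 − TERM[a[k↦0]])`.) [this work] -/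
theorem term_ge_disj_giants (s : ℕ) (a : κ → ℕ) (g : κ → ℝ) (j : ℕ) (hg : ∀ k, 0 ≤ g k ∧ g k ≤ 1) (G : Finset κ)
    (hG : ∀ k ∈ G, j + 1 ≤ s + a k) : 1 - ∏ k ∈ G, (1 - g k) ≤ TERM[s, a, g, j] := by
  induction G using Finset.induction_on generalizing a with
  | empty =>
    rw [Finset.prod_empty, sub_self]
    exact term_nonneg s a g j hg
  | @insert k G hkG ih =>
    have hk : j + 1 ≤ s + a k := hG k (Finset.mem_insert_self k G)
    -- the other giants stay giants after emptying `k`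
    have hG' : ∀ k' ∈ G, j + 1 ≤ s + Function.update a k 0 k' := by
      intro k' hk'
      rw [Function.update_of_ne (ne_of_mem_of_not_mem hk' hkG)]
      exact hG k' (Finset.mem_insert_of_mem hk')
    have ih' := ih (Function.update a k 0) hG'
    rw [term_cond s a g j k, term_eq_one_of_sure (s + a k) _ g j (hk.trans le_rfl), Finset.prod_insert hkG]
    have h1 : 0 ≤ 1 - g k := by linarith [(hg k).2]
    nlinarith [mul_le_mul_of_nonneg_left ih' h1]

/-! ### 3. Rule ∧ — one witness set -/

/-- **Rule ∧ (ONE WITNESS SET).**  Gates in `[0,1]`; `S` any finset with `j + 1 ≤ s + Σ_{k∈S} a k`.  Then `∏_{k∈S} g k ≤ TERM[s, a, g, j]`: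
the term is at least the probability that every blob of `S` is open.  (Induction on `S` with `term_cond`, keeping only the branch
'`k` open'.) [this work] -/
theorem prod_le_term_of_witness (s : ℕ) (a : κ → ℕ) (g : κ → ℝ) (j : ℕ) (hg : ∀ k, 0 ≤ g k ∧ g k ≤ 1) (S : Finset κ)
    (hS : j + 1 ≤ s + ∑ k ∈ S, a k) : ∏ k ∈ S, g k ≤ TERM[s, a, g, j] := by
  induction S using Finset.induction_on generalizing s a with
  | empty =>
    rw [Finset.sum_empty, add_zero] at hS
    rw [Finset.prod_empty, term_eq_one_of_sure s a g j hS]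
  | @insert k S hkS ih =>
    rw [Finset.sum_insert hkS] at hS
    have e : ∑ k' ∈ S, Function.update a k 0 k' = ∑ k' ∈ S, a k' :=
      Finset.sum_congr rfl fun k' hk' => by rw [Function.update_of_ne (ne_of_mem_of_not_mem hk' hkS)]
    have hS' : j + 1 ≤ (s + a k) + ∑ k' ∈ S, Function.update a k 0 k' := by
      rw [e, add_assoc]; exact hS
    have ih' := ih (s + a k) (Function.update a k 0) hS'
    rw [Finset.prod_insert hkS, term_cond s a g j k]
    have h0 : 0 ≤ (1 - g k) * TERM[s, Function.update a k 0, g, j] :=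
      mul_nonneg (by linarith [(hg k).2]) (term_nonneg s _ g j hg)
    nlinarith [mul_le_mul_of_nonneg_left ih' (hg k).1, Finset.prod_nonneg fun k' (_ : k' ∈ S) => (hg k').1]

end RootDec

end Quant

end Summit.CriticalPhenomena.PercolationContinuityZ3.Theorems
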